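import Summits.ResolutionOfSingularities.ResolutionOfSingularities.Theorems.FrobeniusLadderFInjectiveMacaulayficationOnExceptionalDeform
import Summits.ResolutionOfSingularities.ResolutionOfSingularities.Theorems.FrobeniusLadderFInjectiveMacaulayficationQuotLocalizationIso
import Summits.ResolutionOfSingularities.ResolutionOfSingularities.Theorems.FrobeniusLadderFInjectiveMacaulayficationBlowupFiModelOfCover
import Summits.ResolutionOfSingularities.ResolutionOfSingularities.Theorems.FrobeniusLadderFInjectiveMacaulayficationDegreeZeroDescentLocal
import Literature.AlgebraicGeometry.Resolution.AffineBlowupAlgebra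
import Literature.AlgebraicGeometry.Resolution.AffineDomainEquidim
import Mathlib.RingTheory.KrullDimension.Polynomial
import Mathlib.RingTheory.Localization.LocalizationLocalization
import Mathlib.RingTheory.Localization.Away.Basic
import Mathlib.RingTheory.Polynomial.Quotient
import Mathlib.RingTheory.FiniteType
import HarnessLib

/-!
# Generic descent steps of the graded engine (crux `FInjectiveMacaulayfication`, §16 G4, generic half)

Support file for crux stmt-ResolutionOfSingularities-15315 (`FrobeniusLadder.FInjectiveMacaulayfication`), §16 THE
GRADED ENGINE (CRUX-PLAN w45a v3, line `graded-engine`, registered stub G4 `stub_gradedChartClause`; lead seat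
res-L1-w45a-lead-1; design memo GRADED-ENGINE.md v2, steps (iii)–(vi)). [OURS · L1 W4.5a]

The ring-theoretic glue of the graded engine that does not depend on the weighted setting, stated for arbitrary rings
so that the assembly only instantiates:
* `finiteType_blowupAlgebra` — `R[I/a]` is of finite type over `R` when `I` is finitely generated;
* `ringKrullDim_localization_polynomial_succ` — for an affine domain `A`, `dim A[Y]_𝔑 = dim A_𝔫 + 1` at maximal
  ideals (the `hdim` input of `LaurentDescent.laurentDescent`);
* `clause_localization_polynomial_of_mem` — for a Noetherian domain `L` of characteristic `p` satisfying the clause at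
  every prime, `L[s]` satisfies the full stalk clause at every prime containing `s` (Fedder deformation E1
  `OnExceptionalDeform`, p136373, along `L[s]_Q/(s) ≅ L_𝔮`);
* `clause_of_isLocalization_away` — if `S` is the localisation of `A[Y]` at `Y` along `e` and `S` satisfies the
  clause at its maximal ideals containing `b'`, then `A[Y]_𝔑` satisfies the clause at every maximal `𝔑 ∌ Y` such
  that `b' ∈ 𝔑 S` (up to a unit).
No definitions, no named facts. [folklore]
-/

set_option linter.dupNamespace false

noncomputable section

open Polynomial Literature.AlgebraicGeometry.Resolution

namespace Summit.ResolutionOfSingularities.ResolutionOfSingularities.Theorems.FInjectiveMacaulayfication.GradedChartDescent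

open Summit.ResolutionOfSingularities.ResolutionOfSingularities.Theorems.FInjectiveMacaulayfication

/-! ## Finite type of affine blow-up algebras -/

/-- **`R[I/a]` is of finite type over `R`** when `I` is finitely generated: it is generated by the `g/a` for `g`
in a finite generating set of `I` (`x = ∑ r_g g ⇒ x/a = ∑ r_g (g/a)`). [folklore] -/
theorem finiteType_blowupAlgebra {R : Type} [CommRing R] (I : Ideal R) (hI : I.FG) (a : R) :
    Algebra.FiniteType R (blowupAlgebra I a) := by
  classical
  obtain ⟨G, hG⟩ := hI
  have key : Algebra.adjoin R ((fun g : R => algebraMap R (Localization.Away a) g * IsLocalization.Away.invSelf a) '' (G : Set R)) =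
      blowupAlgebra I a := by
    apply le_antisymm
    · refine Algebra.adjoin_le ?_
      rintro _ ⟨g, hg, rfl⟩
      refine div_mem_blowupAlgebra I a ?_
      rw [← hG]
      exact Ideal.subset_span hg
    · refine Algebra.adjoin_le ?_
      rintro _ ⟨x, hx, rfl⟩
      rw [← hG] at hx
      refine Submodule.span_induction (p := fun x _ => algebraMap R (Localization.Away a) x * IsLocalization.Away.invSelf a ∈
          Algebra.adjoin R ((fun g : R => algebraMap R (Localization.Away a) g * IsLocalization.Away.invSelf a) '' (G : Set R)))
        ?_ ?_ ?_ ?_ hx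
      · intro g hg
        exact Algebra.subset_adjoin ⟨g, hg, rfl⟩
      · simp
      · intro x y _ _ hx hy
        rw [map_add, add_mul]
        exact Subalgebra.add_mem _ hx hy
      · intro r x _ hx
        rw [smul_eq_mul, map_mul, mul_assoc]
        exact Subalgebra.mul_mem _ (Subalgebra.algebraMap_mem _ r) hx
  rw [← Subalgebra.fg_iff_finiteType, Subalgebra.fg_def]
  exact ⟨_, (G.finite_toSet.image _), key⟩

/-! ## Dimensions of affine domains -/

/-- For an affine domain `A` over a field, `dim A[Y]_𝔑 = dim A_𝔫 + 1` at maximal ideals `𝔫 ⊆ A`, `𝔑 ⊆ A[Y]`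
(both local dimensions equal the global ones, Matsumura Thm 5.6, and `dim A[Y] = dim A + 1`). [folklore] -/
theorem ringKrullDim_localization_polynomial_succ (k A : Type) [Field k] [CommRing A] [IsDomain A] [Algebra k A]
    [Algebra.FiniteType k A] (𝔫 : Ideal A) [𝔫.IsMaximal] (𝔑 : Ideal (Polynomial A)) [𝔑.IsMaximal] :
    ∀ d : ℕ, ringKrullDim (Localization.AtPrime 𝔫) = d →
      ringKrullDim (Localization.AtPrime 𝔑) = ((d + 1 : ℕ) : WithBot ℕ∞) := by
  intro d hd
  haveI : IsNoetherianRing A := Algebra.FiniteType.isNoetherianRing k A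
  rw [ringKrullDim_localization_atPrime_eq_of_isMaximal k 𝔑, Polynomial.ringKrullDim_of_isNoetherianRing,
    ← ringKrullDim_localization_atPrime_eq_of_isMaximal k 𝔫, hd]
  rfl

/-! ## The clause for `L[s]` on the divisor `s = 0`, by deformation -/

/-- **`L[s]` on `s = 0`.** Let `L` be a Noetherian domain of characteristic `p` whose local rings at ALL primes satisfy
the clause (every system of parameters weakly regular with Frobenius closed ideal). Then for every prime `Q ∋ s` of
`L[s]` the local ring `L[s]_Q` is a domain satisfying the clause: `L[s]_Q/(s) ≅ (L[s]/(s))_{Q/(s)} ≅ L_𝔮`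
(`QuotLocalizationIso`, `Polynomial.quotientSpanXSubCAlgEquiv`) satisfies it, and Fedder's deformation E1
(`OnExceptionalDeform.stub_onExceptionalDeform`, p136373) lifts it along the non-zero-divisor `s`. [folklore] -/
theorem clause_localization_polynomial_of_mem (p : ℕ) [Fact p.Prime] (L : Type) [CommRing L] [IsDomain L]
    [IsNoetherianRing L] [CharP L p]
    (hL : ∀ (𝔮 : Ideal L) [𝔮.IsPrime], ∀ d : ℕ, ringKrullDim (Localization.AtPrime 𝔮) = d →
      ∀ s : Fin d → Localization.AtPrime 𝔮, (Ideal.span (Set.range s)).radical.IsMaximal →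
        RingTheory.Sequence.IsWeaklyRegular (Localization.AtPrime 𝔮) (List.ofFn s) ∧
        ∀ y : Localization.AtPrime 𝔮, (∃ e : ℕ, y ^ p ^ e ∈ Ideal.span
          ((fun z : Localization.AtPrime 𝔮 => z ^ p ^ e) '' (Ideal.span (Set.range s) : Set (Localization.AtPrime 𝔮)))) →
          y ∈ Ideal.span (Set.range s))
    (Q : Ideal (Polynomial L)) [Q.IsPrime] (hXQ : (Polynomial.X : Polynomial L) ∈ Q) :
    IsDomain (Localization.AtPrime Q) ∧
      ∀ d : ℕ, ringKrullDim (Localization.AtPrime Q) = d → ∀ s : Fin d → Localization.AtPrime Q,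
        (Ideal.span (Set.range s)).radical.IsMaximal →
          RingTheory.Sequence.IsWeaklyRegular (Localization.AtPrime Q) (List.ofFn s) ∧
          ∀ y : Localization.AtPrime Q, (∃ e : ℕ, y ^ p ^ e ∈ Ideal.span
            ((fun z : Localization.AtPrime Q => z ^ p ^ e) ''
              (Ideal.span (Set.range s) : Set (Localization.AtPrime Q)))) → y ∈ Ideal.span (Set.range s) := by
  refine OnExceptionalDeform.stub_onExceptionalDeform p (Polynomial L) Polynomial.X Polynomial.X_ne_zero Q hXQ ?_
  -- the prime `Q/(s)` of `L[s]/(s)` and the corresponding prime `𝔮` of `L`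
  haveI hQ' : (Q.map (Ideal.Quotient.mk (Ideal.span {(Polynomial.X : Polynomial L)}))).IsPrime :=
    Ideal.map_isPrime_of_surjective Ideal.Quotient.mk_surjective (by
      rw [Ideal.mk_ker]; exact (Ideal.span_singleton_le_iff_mem _).mpr hXQ)
  have hcomap : (Q.map (Ideal.Quotient.mk (Ideal.span {(Polynomial.X : Polynomial L)}))).comap
      (Ideal.Quotient.mk (Ideal.span {(Polynomial.X : Polynomial L)})) = Q := by
    rw [Ideal.comap_map_of_surjective _ Ideal.Quotient.mk_surjective, ← RingHom.ker_eq_comap_bot, Ideal.mk_ker, sup_eq_left]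
    exact (Ideal.span_singleton_le_iff_mem _).mpr hXQ
  obtain ⟨e₁⟩ := QuotLocalizationIso.stub_quotLocalizationIso (Polynomial L) Polynomial.X Q
    (Q.map (Ideal.Quotient.mk (Ideal.span {(Polynomial.X : Polynomial L)}))) hcomap
  -- `L[s]/(s) ≅ L`
  have hspan : Ideal.span {(Polynomial.X : Polynomial L)} = Ideal.span {Polynomial.X - Polynomial.C (0 : L)} := by
    rw [map_zero, sub_zero]
  let e₂ : (Polynomial L ⧸ Ideal.span {(Polynomial.X : Polynomial L)}) ≃+* L :=
    (Ideal.quotEquivOfEq hspan).trans (Polynomial.quotientSpanXSubCAlgEquiv (0 : L)).toRingEquiv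
  -- the prime `𝔮` of `L`
  set 𝔮 : Ideal L := (Q.map (Ideal.Quotient.mk (Ideal.span {(Polynomial.X : Polynomial L)}))).comap e₂.symm.toRingHom
    with h𝔮
  haveI : 𝔮.IsPrime := Ideal.comap_isPrime _ _
  obtain ⟨e₃⟩ := BlowupFiModelOfCover.nonempty_ringEquiv_localization_of_ringEquiv e₂
    (Q.map (Ideal.Quotient.mk (Ideal.span {(Polynomial.X : Polynomial L)}))) 𝔮 (fun x => by
      rw [h𝔮, Ideal.mem_comap]
      simp)
  exact DegreeZeroDescent.inlineClause_of_ringEquiv p (e₁.trans e₃).symm (hL 𝔮)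

/-! ## Pulling the clause back along a localisation `A[Y] → A[Y][1/Y] = S` -/

/-- **Clause transport along `A[Y] → S = A[Y]_Y`.** Let `e : A[Y] → S` exhibit `S` as the localisation of `A[Y]` at
`Y`, and suppose the local rings of `S` at its maximal ideals containing `b'` satisfy the clause. Let `𝔑 ∌ Y` be a
maximal ideal of `A[Y]` with `b' ∈ S·e(𝔑)`. Then `A[Y]_𝔑` satisfies the clause: `e(𝔑) S` is a proper (prime) ideal,
any maximal `𝔫' ⊇ e(𝔑) S` contracts to `𝔑` and contains `b'`, and `S_{𝔫'} ≅ A[Y]_𝔑` (localisation of a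
localisation). [folklore] -/
theorem clause_of_isLocalization_away (p : ℕ) {A S : Type} [CommRing A] [CommRing S] (e : Polynomial A →+* S)
    (hloc : @IsLocalization.Away (Polynomial A) _ Polynomial.X S _ e.toAlgebra) (b' : S)
    (hcl : ∀ (𝔫' : Ideal S) [𝔫'.IsMaximal], b' ∈ 𝔫' →
      ∀ d : ℕ, ringKrullDim (Localization.AtPrime 𝔫') = d → ∀ s : Fin d → Localization.AtPrime 𝔫',
        (Ideal.span (Set.range s)).radical.IsMaximal →
          RingTheory.Sequence.IsWeaklyRegular (Localization.AtPrime 𝔫') (List.ofFn s) ∧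
          ∀ y : Localization.AtPrime 𝔫', (∃ e : ℕ, y ^ p ^ e ∈ Ideal.span
            ((fun z : Localization.AtPrime 𝔫' => z ^ p ^ e) ''
              (Ideal.span (Set.range s) : Set (Localization.AtPrime 𝔫')))) → y ∈ Ideal.span (Set.range s))
    (𝔑 : Ideal (Polynomial A)) [𝔑.IsMaximal] (hX : (Polynomial.X : Polynomial A) ∉ 𝔑)
    (hb' : ∃ y ∈ 𝔑, ∃ a : S, b' = a * e y) :
    ∀ d : ℕ, ringKrullDim (Localization.AtPrime 𝔑) = d → ∀ s : Fin d → Localization.AtPrime 𝔑,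
      (Ideal.span (Set.range s)).radical.IsMaximal →
        RingTheory.Sequence.IsWeaklyRegular (Localization.AtPrime 𝔑) (List.ofFn s) ∧
        ∀ y : Localization.AtPrime 𝔑, (∃ e : ℕ, y ^ p ^ e ∈ Ideal.span
          ((fun z : Localization.AtPrime 𝔑 => z ^ p ^ e) ''
            (Ideal.span (Set.range s) : Set (Localization.AtPrime 𝔑)))) → y ∈ Ideal.span (Set.range s) := by
  letI : Algebra (Polynomial A) S := e.toAlgebra
  haveI : IsLocalization.Away (Polynomial.X : Polynomial A) S := hloc
  have halg : ∀ y, algebraMap (Polynomial A) S y = e y := fun y => by rw [RingHom.algebraMap_toAlgebra]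
  -- `𝔑` misses the powers of `Y`
  have hdisj : Disjoint (Submonoid.powers (Polynomial.X : Polynomial A) : Set (Polynomial A)) (𝔑 : Set (Polynomial A)) := by
    rw [Set.disjoint_left]
    rintro _ ⟨m, rfl⟩ hm
    exact hX (Ideal.IsPrime.mem_of_pow_mem inferInstance m hm)
  -- a maximal ideal `𝔫'` of `S` over `𝔑`
  have hJ : (𝔑.map (algebraMap (Polynomial A) S)).IsPrime :=
    IsLocalization.isPrime_of_isPrime_disjoint (Submonoid.powers (Polynomial.X : Polynomial A)) S 𝔑 inferInstance hdisj
  obtain ⟨𝔫', h𝔫', hJle⟩ := Ideal.exists_le_maximal _ hJ.ne_top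
  have hcomap : 𝔫'.comap (algebraMap (Polynomial A) S) = 𝔑 :=
    (Ideal.IsMaximal.eq_of_le inferInstance (Ideal.comap_ne_top _ h𝔫'.ne_top)
      (Ideal.map_le_iff_le_comap.mp hJle)).symm
  have hb'mem : b' ∈ 𝔫' := by
    obtain ⟨y, hy, a, rfl⟩ := hb'
    exact 𝔫'.mul_mem_left a (hJle (halg y ▸ Ideal.mem_map_of_mem _ hy))
  -- `S_{𝔫'}` is `A[Y]` localised at `𝔑`
  have h1 : IsLocalization.AtPrime (Localization.AtPrime 𝔫') (𝔫'.comap (algebraMap (Polynomial A) S)) :=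
    IsLocalization.isLocalization_isLocalization_atPrime_isLocalization (Submonoid.powers (Polynomial.X : Polynomial A))
      (Localization.AtPrime 𝔫') 𝔫'
  subst hcomap
  haveI := h1
  exact DegreeZeroDescent.inlineClause_of_ringEquiv p
    (IsLocalization.algEquiv (𝔫'.comap (algebraMap (Polynomial A) S)).primeCompl
      (Localization.AtPrime (𝔫'.comap (algebraMap (Polynomial A) S))) (Localization.AtPrime 𝔫')).toRingEquiv.symm
    (hcl 𝔫' hb'mem)

end Summit.ResolutionOfSingularities.ResolutionOfSingularities.Theorems.FInjectiveMacaulayfication.GradedChartDescent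

end
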